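import Summits.AtomisticToContinuum.HydrodynamicLimit.Theses.ResponseRigidity

/-!
# Birth skeleton of the crux `SlavedContactSynergy` (stmt-AtomisticToContinuum-15324)

Route `route-AtomisticToContinuum-ResponseRigidity` (rank-2 crux), crux decl
`Summit.AtomisticToContinuum.HydrodynamicLimit.Theses.ResponseRigidity.SlavedContactSynergy`.
Skeleton registrar `planner-skel-stmt-AtomisticToContinuum-15324-0`, 2026-08-17 (BC3 birth certificate of the
crux; re-audit bin REPAIRABLE). The crux says: under the thickened incoming-contact flux measure of the local
Gibbs law `LG_τ`, the pairing `I` of the ⊥ collision difference `ψ(v₀) − ψ(v₀')` with the OUTGOING pair synergy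
`S∘collidePair`, `S = μ₂ − μ₁ − μ₁'`, is `≤ ϵ·‖r‖_{L²(LG_τ)} + κ'` for every `ϵ > 0` once the packing band is
small (`r = μ₁ −` affine function of sphere 0's collision invariants). Its informal mechanism has three clauses —
"synergy at outgoing contact is carried only by prompt re-encounter episodes" / "through which conserved content
passes additively, so only the ⊥-part of the response is visible" / "with weight = re-encounter probability → 0
with the packing" — and the three stubs below are exactly these three clauses, typed (the route header's foreseen
split `EpisodeTermination → SeparatedPairAdditivity → SlavedContactSynergy`, TWO-LAYER PLAN, made precise):

* the OBJECT of the line is the PROMPT RE-ENCOUNTER EVENT `episodeSet σ N Φ K` of the outgoing pair `(0,1)`: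
  along the hard-sphere orbit of the outgoing configuration, within `K` kinetic time units `(N+1)^{-1/3}` (a mean
  free time up to the factor `σ⁻²`; the same clock as the route's `RenewalDefect` step `r = d(N+1)^{-1/3}`),
  EITHER spheres `0` and `1` are again within two diameters AND approaching (direct re-approach: knock-back before
  separation or re-entry on a collision course — an outgoing pair in free flight stays outgoing), OR some third
  sphere `k` passes within two diameters of sphere `0` and within two diameters of sphere `1` (the one-intermediary
  ring `0 → k → 1`). It splits the crux's pairing as
  `I = (I − I_K) + I_K`, `I_K` := the same flux pairing with `S` replaced by `𝟙_{episodeSet} · S`.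
* `stub_separatedPairAdditivity` (S1, SEPARATED-PAIR ADDITIVITY + EPISODE TERMINATION; the crux's named risk, size
  L / open): for every `ϵ₀ > 0` there is a window `K(ϵ₀)` and a packing band such that the NON-episode part
  `I − I_K` is `≤ ϵ₀‖r‖₂ + κ'` eventually in `N`: pairs whose prompt window is episode-free are generic afterwards
  (pure pair-interaction Hoeffding component `o(1)` at the `(N+1)` scale — Bessel / Efron–Stein from CLT-scale
  variances, EfronStein1981, Duerinckx2021), and LATE low-order re-encounters carry only the `K`-tail `∫_K^∞ dτ/τ²
  = 1/K` of the convergent `d = 3` ring integral (Cohen; `Literature…NoDensityExpansion`), through which conserved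
  content again passes additively (slaved form, constant `→ 0` as `K → ∞`).
* `stub_episodeSlaving` (S2, CONSERVED CONTENT PASSES ADDITIVELY; size M–L): IF the episode event has conditional
  flux weight `≤ ϵ₁` uniformly in the state of sphere `0`, incoming and outgoing (`EpisodeWeightBound`, the interface
  Prop), THEN
  the episode part `I_K` is `≤ ϵ‖r‖₂ + κ'` with `ϵ₁ = ϵ₁(ϵ)` UNIVERSAL (this is what the crux's normalisations
  `|φw| ≤ 1`, `‖p‖_{L²(γ)} ≤ 1` buy): on an episode the synergy is, to `o(1)`, a signed sum of values of the
  residual `r` (a re-encounter re-distributes mass, momentum and energy between the partners ADDITIVELY, so the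
  affine-in-collision-invariants part of `μ₁ + μ₁'` produces no synergy; `α, β, γ` continuous and the partners a
  diameter apart), and Cauchy–Schwarz against the conditional weight gives `√ϵ₁ · C · ‖r‖₂` (exchangeability of
  `LG_τ` and symmetry of the fields give `‖r'‖₂ = ‖r‖₂` for the partner's residual).
* `stub_episodeWeight` (S3, PROMPT RE-ENCOUNTERS ARE RARE IN THE DILUTE BAND; a Lanford-type recollision/ring
  estimate at fixed small packing over `K` kinetic times, size M–L): for every window `K` and every `ϵ₁ > 0` there
  is a packing band `η(K, ϵ₁)` in which `EpisodeWeightBound … η' K ϵ₁` holds eventually in `N` for every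
  `τ ∈ [0, t]`: a deflected partner must be aimed back at a target of angular size `(a/r)²`, `∫ (dr/ℓ)(a/r)² ≍ a/ℓ ≍`
  packing (GST2013 Ch. 12 recollision geometry; tree: `TaggedSphereNoDoubleCollision`, `CollisionWindowCompensator`).
* Composition `SlavedContactSynergy_of : S1 → S2 → S3 → SlavedContactSynergy` (sorry-free): `K` and `η₁` from S1 at
  `ϵ/2`, `ϵ₁` and `η₂` from S2 at `ϵ/2`, `η₃` from S3 at `(K, ϵ₁)`; packing band `min η₁ (min η₂ η₃)`, density
  threshold `min σ₁ (min σ₂ σ₃)`, thickening threshold `min`, particle threshold `max`, S3's conclusion fed into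
  S2's hypothesis BY NAME, and the triangle inequality `|I| ≤ |I − I_K| + |I_K|` at `κ'/2 + κ'/2`.

Quantifier discipline (why the cut is this one and not the naive `κ'`-only split): the crux fixes the packing band
`η(ϵ)` BEFORE the test data and `κ'`, so the window `K` must be chosen from `ϵ` alone (S1 in slaved form), which in
turn lets S3's band depend on `K` — the honest form of "weight `≤ C(K)·packing`" (one-intermediary rings launched at
distance `r ∈ [ℓ, Kℓ]` cost `(a/ℓ)² log K`, so no `K`-uniform weight bound is claimed).

Disproof used: none exists for this crux at registration (`ledger crux ls stmt-AtomisticToContinuum-15324`: no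
workfiles). Negatives index (`ledger negatives --problem AtomisticToContinuum`, 20 entries): no refuted statement is
an instance of S1–S3; the one lesson that bears (LanfordEnvelope, stmt-11470, refuted-misstated: never evaluate
`Φ.flow` pointwise off the Liouville-conull good set) is honoured — every occurrence of the flow here sits under an
integral against `LG_τ ≪` Liouville, composed with the volume-preserving involution `collidePair`.
-/

noncomputable section

open scoped BigOperators Topology Classical MeasureTheory ProbabilityTheory InnerProductSpace
open Filter Set Function MeasureTheory

namespace Summit.AtomisticToContinuum.HydrodynamicLimit.Cruxes.SlavedContactSynergy.Birth

open Literature.MathematicalPhysics.KineticTheory Literature.Analysis.FluidPDE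
open Summit.AtomisticToContinuum.HydrodynamicLimit.Theses

/-! ## §0 Objects of the line -/

/-- **The prompt re-encounter event of the outgoing pair `(0, 1)`** within `K` kinetic time units
`(N+1)^{-1/3}` along the orbit of `Φ` started at an (outgoing) configuration `z`: EITHER a direct re-approach — at
some time in the window spheres `0` and `1` are within two diameters AND approaching (`IsIncoming`; an outgoing pair
in free flight stays outgoing, so this happens only after a deflection: knock-back before separation, or re-entry
from afar on a collision course) — OR a one-intermediary ring (a third sphere `k` passes within `2a` of sphere `0` at
some time and within `2a` of sphere `1` at some time, both inside the window; `a = hsDiameter σ N`). Open conditions,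
so that on the good set (positions continuous, velocities piecewise continuous in time) the event is a countable
union over rational times; it is only ever used under `LG_τ`-integrals composed with `collidePair` (Liouville-null
junk of `Φ.flow` off the good set is invisible). Over-inclusive by design (a near re-pass is not a recollision):
that only strengthens S3 and weakens S1. -/
def episodeSet (σ : ℝ) (N : ℕ) (Φ : HardSphereFlow (Torus.geometry (Fin 3)) (hsDiameter σ N) (N + 1)) (K : ℝ) :
    Set (Config (N + 1) (Fin 3) T3) :=
  {z | (∃ s : ℝ, 0 ≤ s ∧ s ≤ K * (((N : ℝ) + 1) ^ (-(1 / 3 : ℝ))) ∧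
        ‖(Torus.geometry (Fin 3)).sepVec ((Φ.flow s z) 0).1 ((Φ.flow s z) 1).1‖ < 2 * hsDiameter σ N ∧
        IsIncoming (Torus.geometry (Fin 3)) (Φ.flow s z) 0 1) ∨
      (∃ k : Fin (N + 1), k ≠ 0 ∧ k ≠ 1 ∧ ∃ s₁ s₂ : ℝ, 0 ≤ s₁ ∧ s₁ ≤ K * (((N : ℝ) + 1) ^ (-(1 / 3 : ℝ))) ∧
        0 ≤ s₂ ∧ s₂ ≤ K * (((N : ℝ) + 1) ^ (-(1 / 3 : ℝ))) ∧
        ‖(Torus.geometry (Fin 3)).sepVec ((Φ.flow s₁ z) 0).1 ((Φ.flow s₁ z) k).1‖ < 2 * hsDiameter σ N ∧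
        ‖(Torus.geometry (Fin 3)).sepVec ((Φ.flow s₂ z) 1).1 ((Φ.flow s₂ z) k).1‖ < 2 * hsDiameter σ N)}

/-- **The interface between S3 and S2: uniform conditional smallness of the episode weight.** Under the local
Gibbs law `P = localGibbsLaw σ a₁ u₁ θ₁ N Φ`, on the thickened incoming-contact set `A` (thickening `η'`) with the
flux weight `wt = |⟨n̂, v₀ − v₁⟩|`, the flux weight of `{collidePair z ∈ episodeSet}` is at most `ϵ₁` times the total
flux weight AFTER testing against any measurable `g` with `0 ≤ g ≤ 1` of (i) the INCOMING state `z 0 = (q₀, v₀)` of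
sphere `0`, and (ii) its OUTGOING state `collidePair z 0 = (q₀, v₀')` — i.e. the prompt re-encounter probability is
`≤ ϵ₁` conditionally on sphere 0's state on either side of the collision (the partner's velocity is averaged under its
flux-conditional law, which is what disposes of slow relative speeds; a bound pointwise in the PAIR state would be
false for `|v₀ − v₁| → 0`). These are exactly the two conditionings S2's Cauchy–Schwarz consumes (`ψ(z)` is a function
of `z 0`, `ψout z` and the residual `r` after the flux involution are functions of `collidePair z 0`), and they make
its constant independent of the test function `p`. Homogeneous in the normalisation `Z`; Bochner-junk-free (`g ≤ 1`,
`wt ≤ ‖v₀ − v₁‖` integrable under the Gaussian velocities of `localGibbsLaw`). -/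
def EpisodeWeightBound (σ : ℝ) (a₁ : T3 → ℝ) (u₁ : T3 → V3) (θ₁ : T3 → ℝ) (N : ℕ)
    (Φ : HardSphereFlow (Torus.geometry (Fin 3)) (hsDiameter σ N) (N + 1)) (η' K ϵ₁ : ℝ) : Prop :=
  let G3 := Torus.geometry (Fin 3)
  let P : Measure (Config (N + 1) (Fin 3) T3) := localGibbsLaw σ a₁ u₁ θ₁ N Φ
  let wt : Config (N + 1) (Fin 3) T3 → ℝ :=
    fun z => |⟪G3.sepVec (z 0).1 (z 1).1, (z 0).2 - (z 1).2⟫_ℝ| / ‖G3.sepVec (z 0).1 (z 1).1‖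
  let A : Set (Config (N + 1) (Fin 3) T3) :=
    {z | ‖G3.sepVec (z 0).1 (z 1).1‖ < hsDiameter σ N * (1 + η') ∧ IsIncoming G3 z 0 1}
  let E : Set (Config (N + 1) (Fin 3) T3) := episodeSet σ N Φ K
  ∀ g : T3 × V3 → ℝ, Measurable g → (∀ y, 0 ≤ g y) → (∀ y, g y ≤ 1) →
    (∫ z, A.indicator (fun z => wt z * E.indicator (fun _ => (1 : ℝ)) (collidePair G3 0 1 z) * g (z 0)) z ∂P ≤
        ϵ₁ * ∫ z, A.indicator (fun z => wt z * g (z 0)) z ∂P) ∧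
    (∫ z, A.indicator (fun z => wt z * E.indicator (fun _ => (1 : ℝ)) (collidePair G3 0 1 z) *
          g (collidePair G3 0 1 z 0)) z ∂P ≤
        ϵ₁ * ∫ z, A.indicator (fun z => wt z * g (collidePair G3 0 1 z 0)) z ∂P)

/-! ## §1 Stub signatures

Each stub's statement is the `Prop` `Sig.stub_<name>` (the crux's own quantifier prefix and `let`-vocabulary,
copied verbatim, so that the composition is pure logic); the registered obligation is
`theorem stub_<name> : Sig.stub_<name> := by sorry` (§2); the composition `SlavedContactSynergy_of` takes the three
signatures as hypotheses BY NAME. -/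

/-- **S1 — separated-pair additivity with episode termination (THE HEART; size L, the crux's named risk).** For
every `ϵ₀ > 0` there are a window length `K > 0` (kinetic time units) and a packing band `η > 0` such that, in the
crux's own frame (Euler activity family, ⊥-test function `ψ = φw · p` in the unit ball, far-future tested conserved
field `F`, thresholds `η'₀(…)`, `N₀(η')`), the part of the synergy pairing NOT carried by prompt episodes,
`I − I_K`, is at most `ϵ₀ ‖r‖_{L²(LG_τ)} + κ'`. Why plausibly true: off `episodeSet` the outgoing partners' influence
cascades first interact either LATE and at low order (weight the `K`-tail `1/K` of the `d = 3` ring integral,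
synergy again a signed sum of residuals `r` — slaved) or GENERICALLY (the pure pair-interaction Hoeffding component
of `E[F | z₀, z₁]` is `o((N+1)⁻¹)` for pairs in generic relative position, by exchangeability + CLT-scale variance —
Bessel / Efron–Stein); higher-order PROMPT rings (`≥ 2` intermediaries, weight `≍` packing² per order) are the
honest residue and must be slaved too. Why it might fail = the crux's why-line verbatim: O(1) cascade-merging
synergy beyond prompt re-encounters, or a hidden two-body quasi-conserved quantity. Leans on:
`ResponseRigidity.CLTScaleConcentration` (for ‖μ₁‖₂, ‖S‖₂ = O(1), as a hypothesis if wanted), `MeasureTheory.condExp`,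
`Literature…HardSphereCollisionRecord` (DAG / ring vocabulary), EfronStein1981, Duerinckx2021, Spohn1991 §7. -/
def Sig.stub_separatedPairAdditivity : Prop :=
  ∀ ϵ₀ : ℝ, 0 < ϵ₀ → ∃ K : ℝ, 0 < K ∧ ∃ η : ℝ, 0 < η ∧ ∀ (a₀ θ₀ : T3 → ℝ) (u₀ : T3 → V3), Continuous a₀ →
    Continuous θ₀ → Continuous u₀ → (∀ x, 0 < a₀ x) → (∀ x, 0 < θ₀ x) → ∃ σ₀ : ℝ, 0 < σ₀ ∧ ∀ σ : ℝ, 0 < σ →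
    σ < σ₀ → ∀ (T : ℝ) (ρ θ : ℝ → T3 → ℝ) (u : ℝ → T3 → V3), IsHardSphereEulerSolution σ T ρ u θ →
    (∀ t ∈ Set.Ico 0 T, ∀ x, ρ t x * σ ^ 3 < η) → ∀ Φ : (N : ℕ) →
    HardSphereFlow (Torus.geometry (Fin 3)) (hsDiameter σ N) (N + 1), TendstoHydroFieldsAt (fun N => localGibbsLaw σ a₀ u₀ θ₀ N (Φ N)) Φ ρ u θ 0 →
    ∀ a : ℝ → T3 → ℝ, a 0 = a₀ → (∀ τ ∈ Set.Ico 0 T, Continuous (a τ) ∧ ∀ x, 0 < a τ x) →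
    (∀ τ ∈ Set.Ico 0 T, ∀ χ : T3 → ℝ, Literature.Analysis.FunctionSpaces.Torus.IsSmooth χ →
    Tendsto (fun N : ℕ => ∫ z, empiricalDensityField z χ ∂(localGibbsLaw σ (a τ) (u τ) (θ τ) N (Φ N))) atTop (𝓝 (∫ x, χ x * ρ τ x)) ∧ (∀ j : Fin 3, Tendsto (fun N : ℕ => ∫ z, empiricalMomentumField z χ j ∂(localGibbsLaw σ (a τ) (u τ) (θ τ) N (Φ N))) atTop (𝓝 (∫ x, χ x * ρ τ x * u τ x j))) ∧ Tendsto (fun N : ℕ => ∫ z, empiricalEnergyField z χ ∂(localGibbsLaw σ (a τ) (u τ) (θ τ) N (Φ N))) atTop (𝓝 (∫ x, χ x * totalEnergyDensity (ρ τ x) (u τ x) (θ τ x)))) →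
    ∀ t ∈ Set.Ico 0 T, ∀ χ : T3 → ℝ, Literature.Analysis.FunctionSpaces.Torus.IsSmooth χ → ∀ φw : T3 →
    ℝ, Continuous φw → (∀ x, |φw x| ≤ 1) → ∀ p : V3 → ℝ, Continuous p →
    (∃ Cp : ℝ, ∀ c, |p c| ≤ Cp * (1 + ‖c‖ ^ 2) ^ 2) →
    (∫ c, p c * Real.exp (-‖c‖ ^ 2 / 2) = 0 ∧ (∀ i : Fin 3, ∫ c, p c * c i * Real.exp (-‖c‖ ^ 2 / 2) = 0) ∧ ∫ c, p c * ‖c‖ ^ 2 * Real.exp (-‖c‖ ^ 2 / 2) = 0) →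
    (∫ c, p c ^ 2 * Real.exp (-‖c‖ ^ 2 / 2) ≤ 1) → ∀ δ : ℝ, 0 < δ → ∀ κ' : ℝ, 0 < κ' →
    ∃ η'₀ : ℝ, 0 < η'₀ ∧ ∀ η' : ℝ, 0 < η' → η' < η'₀ → ∃ N₀ : ℕ, ∀ N : ℕ, N₀ ≤ N → ∀ s τ : ℝ, δ ≤ s → 0 ≤ τ →
    s + τ ≤ t → let G3 := Torus.geometry (Fin 3);
  let P : Measure (Config (N + 1) (Fin 3) T3) := localGibbsLaw σ (a τ) (u τ) (θ τ) N (Φ N);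
  let m0 : MeasurableSpace (Config (N + 1) (Fin 3) T3) := MeasurableSpace.comap (fun z : Config (N + 1) (Fin 3) T3 => z 0) inferInstance;
  let m1 : MeasurableSpace (Config (N + 1) (Fin 3) T3) := MeasurableSpace.comap (fun z : Config (N + 1) (Fin 3) T3 => z 1) inferInstance;
  let m01 : MeasurableSpace (Config (N + 1) (Fin 3) T3) := MeasurableSpace.comap (fun z : Config (N + 1) (Fin 3) T3 => (z 0, z 1)) inferInstance;
  let ψ : Config (N + 1) (Fin 3) T3 →
    ℝ := fun z => φw (z 0).1 * p ((Real.sqrt (θ τ (z 0).1))⁻¹ • ((z 0).2 - u τ (z 0).1));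
  let ψout : Config (N + 1) (Fin 3) T3 →
    ℝ := fun z => φw (z 0).1 * p ((Real.sqrt (θ τ (z 0).1))⁻¹ • (((collidePair G3 0 1 z) 0).2 - u τ (z 0).1));
  let wt : Config (N + 1) (Fin 3) T3 →
    ℝ := fun z => |⟪G3.sepVec (z 0).1 (z 1).1, (z 0).2 - (z 1).2⟫_ℝ| / ‖G3.sepVec (z 0).1 (z 1).1‖;
  let A : Set (Config (N + 1) (Fin 3) T3) := {z | ‖G3.sepVec (z 0).1 (z 1).1‖ < hsDiameter σ N * (1 + η') ∧ IsIncoming G3 z 0 1};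
  let Zn : ℝ := ∫ z, A.indicator wt z ∂P;
  let E : Set (Config (N + 1) (Fin 3) T3) := episodeSet σ N (Φ N) K;
  ∀ F : Config (N + 1) (Fin 3) T3 →
    ℝ, (F = (fun z => empiricalDensityField ((Φ N).flow s z) χ) ∨ (∃ j : Fin 3, F = fun z => empiricalMomentumField ((Φ N).flow s z) χ j) ∨ F = fun z => empiricalEnergyField ((Φ N).flow s z) χ) →
    ∀ (α γ : T3 → ℝ) (β : T3 → V3), Continuous α → Continuous β → Continuous γ →
    let μ1 : Config (N + 1) (Fin 3) T3 →
    ℝ := fun z => ((N : ℝ) + 1) * (MeasureTheory.condExp m0 P F z - ∫ w, F w ∂P);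
  let μ1' : Config (N + 1) (Fin 3) T3 →
    ℝ := fun z => ((N : ℝ) + 1) * (MeasureTheory.condExp m1 P F z - ∫ w, F w ∂P);
  let μ2 : Config (N + 1) (Fin 3) T3 →
    ℝ := fun z => ((N : ℝ) + 1) * (MeasureTheory.condExp m01 P F z - ∫ w, F w ∂P);
  let S : Config (N + 1) (Fin 3) T3 → ℝ := fun z => μ2 z - μ1 z - μ1' z;
  let r : Config (N + 1) (Fin 3) T3 →
    ℝ := fun z => μ1 z - (α (z 0).1 + ⟪β (z 0).1, (z 0).2⟫_ℝ + γ (z 0).1 * ‖(z 0).2‖ ^ 2);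
  Integrable (fun z => r z ^ 2) P → |Zn⁻¹ * ∫ z, A.indicator (fun z => wt z * (ψ z - ψout z) * S (collidePair G3 0 1 z)) z ∂P - Zn⁻¹ * ∫ z, A.indicator (fun z => wt z * (ψ z - ψout z) * E.indicator S (collidePair G3 0 1 z)) z ∂P| ≤ ϵ₀ * Real.sqrt (∫ z, r z ^ 2 ∂P) + κ'

/-- **S2 — conserved content passes additively through an episode (size M–L).** For every `ϵ > 0` there are a
UNIVERSAL conditional-weight threshold `ϵ₁ > 0` and a packing band `η > 0` such that, in the crux's frame and for
every window `K > 0`: IF `EpisodeWeightBound σ (a τ) (u τ) (θ τ) N (Φ N) η' K ϵ₁` (S3's conclusion, by name) THEN the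
episode part of the pairing, `I_K = Z⁻¹ ∫_A wt (ψ − ψout) (𝟙_{episodeSet} S)∘collidePair dLG_τ`, is at most
`ϵ ‖r‖_{L²(LG_τ)} + κ'`. Why plausibly true: on an episode the synergy of the outgoing pair is, up to `o(1)` as
`N → ∞` (continuity of `α, β, γ`, partners a diameter apart), the change of `r(partner states)` across the
re-encounter — the affine-in-`(1, v, |v|²)` part of `μ₁ + μ₁'` is transported additively by any chain of elastic
collisions and produces no synergy — so `|I_K| ≤ ‖(ψ − ψout)·wt^{1/2}‖_{L²} · (conditional weight)^{1/2} · C‖r‖₂`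
by Cauchy–Schwarz against the UNIFORM conditional bound (uniform in sphere 0's incoming state, the variable of
`ψ`, and in its outgoing state, the variable of `ψout` and of `r` after the flux involution `collidePair`); `ϵ₁ := (ϵ/C)²` with `C` universal thanks to
`|φw| ≤ 1`, `∫ p² γ ≤ 1` and Gaussian flux moments; the partner's residual has the same norm by exchangeability of
`localGibbsLaw` and symmetry of the empirical fields. Why it might fail: the flux moment `∫ |c| p(c)² γ(dc)` is not
bounded on the unit `L²(γ)` ball (velocity tails must be cut at a `κ'`-cost using `N ≥ N₀` and the quartic growth of
`p`), and the "signed sum of residuals" picture needs the re-encounter-time responses tied back to time-`0` ones (the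
renewal philosophy of the route, cf. `ResponseRigidity.RenewalDefect`). Leans on: `collidePair` (flux involution,
`Literature…HardSpherePhaseSpace`), `MeasureTheory.condExp`, `EpisodeWeightBound`, CIP1994 §3.1–3.3. -/
def Sig.stub_episodeSlaving : Prop :=
  ∀ ϵ : ℝ, 0 < ϵ → ∃ ϵ₁ : ℝ, 0 < ϵ₁ ∧ ∃ η : ℝ, 0 < η ∧ ∀ (a₀ θ₀ : T3 → ℝ) (u₀ : T3 → V3), Continuous a₀ →
    Continuous θ₀ → Continuous u₀ → (∀ x, 0 < a₀ x) → (∀ x, 0 < θ₀ x) → ∃ σ₀ : ℝ, 0 < σ₀ ∧ ∀ σ : ℝ, 0 < σ →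
    σ < σ₀ → ∀ (T : ℝ) (ρ θ : ℝ → T3 → ℝ) (u : ℝ → T3 → V3), IsHardSphereEulerSolution σ T ρ u θ →
    (∀ t ∈ Set.Ico 0 T, ∀ x, ρ t x * σ ^ 3 < η) → ∀ Φ : (N : ℕ) →
    HardSphereFlow (Torus.geometry (Fin 3)) (hsDiameter σ N) (N + 1), TendstoHydroFieldsAt (fun N => localGibbsLaw σ a₀ u₀ θ₀ N (Φ N)) Φ ρ u θ 0 →
    ∀ a : ℝ → T3 → ℝ, a 0 = a₀ → (∀ τ ∈ Set.Ico 0 T, Continuous (a τ) ∧ ∀ x, 0 < a τ x) →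
    (∀ τ ∈ Set.Ico 0 T, ∀ χ : T3 → ℝ, Literature.Analysis.FunctionSpaces.Torus.IsSmooth χ →
    Tendsto (fun N : ℕ => ∫ z, empiricalDensityField z χ ∂(localGibbsLaw σ (a τ) (u τ) (θ τ) N (Φ N))) atTop (𝓝 (∫ x, χ x * ρ τ x)) ∧ (∀ j : Fin 3, Tendsto (fun N : ℕ => ∫ z, empiricalMomentumField z χ j ∂(localGibbsLaw σ (a τ) (u τ) (θ τ) N (Φ N))) atTop (𝓝 (∫ x, χ x * ρ τ x * u τ x j))) ∧ Tendsto (fun N : ℕ => ∫ z, empiricalEnergyField z χ ∂(localGibbsLaw σ (a τ) (u τ) (θ τ) N (Φ N))) atTop (𝓝 (∫ x, χ x * totalEnergyDensity (ρ τ x) (u τ x) (θ τ x)))) →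
    ∀ t ∈ Set.Ico 0 T, ∀ χ : T3 → ℝ, Literature.Analysis.FunctionSpaces.Torus.IsSmooth χ → ∀ φw : T3 →
    ℝ, Continuous φw → (∀ x, |φw x| ≤ 1) → ∀ p : V3 → ℝ, Continuous p →
    (∃ Cp : ℝ, ∀ c, |p c| ≤ Cp * (1 + ‖c‖ ^ 2) ^ 2) →
    (∫ c, p c * Real.exp (-‖c‖ ^ 2 / 2) = 0 ∧ (∀ i : Fin 3, ∫ c, p c * c i * Real.exp (-‖c‖ ^ 2 / 2) = 0) ∧ ∫ c, p c * ‖c‖ ^ 2 * Real.exp (-‖c‖ ^ 2 / 2) = 0) →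
    (∫ c, p c ^ 2 * Real.exp (-‖c‖ ^ 2 / 2) ≤ 1) → ∀ δ : ℝ, 0 < δ → ∀ K : ℝ, 0 < K → ∀ κ' : ℝ, 0 < κ' →
    ∃ η'₀ : ℝ, 0 < η'₀ ∧ ∀ η' : ℝ, 0 < η' → η' < η'₀ → ∃ N₀ : ℕ, ∀ N : ℕ, N₀ ≤ N → ∀ s τ : ℝ, δ ≤ s → 0 ≤ τ →
    s + τ ≤ t → let G3 := Torus.geometry (Fin 3);
  let P : Measure (Config (N + 1) (Fin 3) T3) := localGibbsLaw σ (a τ) (u τ) (θ τ) N (Φ N);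
  let m0 : MeasurableSpace (Config (N + 1) (Fin 3) T3) := MeasurableSpace.comap (fun z : Config (N + 1) (Fin 3) T3 => z 0) inferInstance;
  let m1 : MeasurableSpace (Config (N + 1) (Fin 3) T3) := MeasurableSpace.comap (fun z : Config (N + 1) (Fin 3) T3 => z 1) inferInstance;
  let m01 : MeasurableSpace (Config (N + 1) (Fin 3) T3) := MeasurableSpace.comap (fun z : Config (N + 1) (Fin 3) T3 => (z 0, z 1)) inferInstance;
  let ψ : Config (N + 1) (Fin 3) T3 →
    ℝ := fun z => φw (z 0).1 * p ((Real.sqrt (θ τ (z 0).1))⁻¹ • ((z 0).2 - u τ (z 0).1));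
  let ψout : Config (N + 1) (Fin 3) T3 →
    ℝ := fun z => φw (z 0).1 * p ((Real.sqrt (θ τ (z 0).1))⁻¹ • (((collidePair G3 0 1 z) 0).2 - u τ (z 0).1));
  let wt : Config (N + 1) (Fin 3) T3 →
    ℝ := fun z => |⟪G3.sepVec (z 0).1 (z 1).1, (z 0).2 - (z 1).2⟫_ℝ| / ‖G3.sepVec (z 0).1 (z 1).1‖;
  let A : Set (Config (N + 1) (Fin 3) T3) := {z | ‖G3.sepVec (z 0).1 (z 1).1‖ < hsDiameter σ N * (1 + η') ∧ IsIncoming G3 z 0 1};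
  let Zn : ℝ := ∫ z, A.indicator wt z ∂P;
  let E : Set (Config (N + 1) (Fin 3) T3) := episodeSet σ N (Φ N) K;
  EpisodeWeightBound σ (a τ) (u τ) (θ τ) N (Φ N) η' K ϵ₁ → ∀ F : Config (N + 1) (Fin 3) T3 →
    ℝ, (F = (fun z => empiricalDensityField ((Φ N).flow s z) χ) ∨ (∃ j : Fin 3, F = fun z => empiricalMomentumField ((Φ N).flow s z) χ j) ∨ F = fun z => empiricalEnergyField ((Φ N).flow s z) χ) →
    ∀ (α γ : T3 → ℝ) (β : T3 → V3), Continuous α → Continuous β → Continuous γ →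
    let μ1 : Config (N + 1) (Fin 3) T3 →
    ℝ := fun z => ((N : ℝ) + 1) * (MeasureTheory.condExp m0 P F z - ∫ w, F w ∂P);
  let μ1' : Config (N + 1) (Fin 3) T3 →
    ℝ := fun z => ((N : ℝ) + 1) * (MeasureTheory.condExp m1 P F z - ∫ w, F w ∂P);
  let μ2 : Config (N + 1) (Fin 3) T3 →
    ℝ := fun z => ((N : ℝ) + 1) * (MeasureTheory.condExp m01 P F z - ∫ w, F w ∂P);
  let S : Config (N + 1) (Fin 3) T3 → ℝ := fun z => μ2 z - μ1 z - μ1' z;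
  let r : Config (N + 1) (Fin 3) T3 →
    ℝ := fun z => μ1 z - (α (z 0).1 + ⟪β (z 0).1, (z 0).2⟫_ℝ + γ (z 0).1 * ‖(z 0).2‖ ^ 2);
  Integrable (fun z => r z ^ 2) P → |Zn⁻¹ * ∫ z, A.indicator (fun z => wt z * (ψ z - ψout z) * E.indicator S (collidePair G3 0 1 z)) z ∂P| ≤ ϵ * Real.sqrt (∫ z, r z ^ 2 ∂P) + κ'

/-- **S3 — prompt re-encounters of an outgoing contact pair are rare in the dilute band (size M–L).** For every
window `K > 0` and every `ϵ₁ > 0` there is a packing band `η > 0` such that for continuous positive profiles,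
`σ < σ₀`, every packing-guarded classical solution, every flow family with the `t = 0` LLN and every Euler activity
family, for `t ∈ [0, T)`: below a thickening threshold and eventually in `N`, `EpisodeWeightBound … η' K ϵ₁` holds at
every `τ ∈ [0, t]` — the flux-conditional probability, given sphere 0's state (incoming or outgoing), that the pair
re-encounters (directly or through one intermediary) within `K` kinetic times is `≤ ϵ₁`. Why plausibly true: a
partner deflected at distance `r` is aimed back at a target of angular size `(a/r)²`, `∫_a^{Kℓ} (dr/ℓ)(a/r)² ≲ a/ℓ ≍`
packing, uniformly in the velocity of sphere `0` (slow relative speeds are averaged over the partner's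
flux-conditional law); one-intermediary rings cost `a/ℓ + (a/ℓ)² log K`; hence `≤ C(K)·η`. Why it might fail:
uniformity in the conditioning (very fast or boxed-in spheres, cold/dense windows of the local Gibbs law inside the
band) and the passage from the Boltzmann–Grad recollision geometry to FIXED small packing over `K` mean free times
(a Lanford short-window argument at positive density, cf. the route's `RigidityTransfer` plan). Leans on:
`HardSphereFlow` (good set, Liouville invariance), `localGibbsLaw`, tree `TaggedSphereNoDoubleCollision`,
`CollisionWindowCompensator`; GST2013 Ch. 12, Bremaud2020 Ch. 17 (Palm calculus of the collision process). -/
def Sig.stub_episodeWeight : Prop :=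
  ∀ K : ℝ, 0 < K → ∀ ϵ₁ : ℝ, 0 < ϵ₁ → ∃ η : ℝ, 0 < η ∧ ∀ (a₀ θ₀ : T3 → ℝ) (u₀ : T3 → V3), Continuous a₀ →
    Continuous θ₀ → Continuous u₀ → (∀ x, 0 < a₀ x) → (∀ x, 0 < θ₀ x) → ∃ σ₀ : ℝ, 0 < σ₀ ∧ ∀ σ : ℝ, 0 < σ →
    σ < σ₀ → ∀ (T : ℝ) (ρ θ : ℝ → T3 → ℝ) (u : ℝ → T3 → V3), IsHardSphereEulerSolution σ T ρ u θ →
    (∀ t ∈ Set.Ico 0 T, ∀ x, ρ t x * σ ^ 3 < η) → ∀ Φ : (N : ℕ) →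
    HardSphereFlow (Torus.geometry (Fin 3)) (hsDiameter σ N) (N + 1), TendstoHydroFieldsAt (fun N => localGibbsLaw σ a₀ u₀ θ₀ N (Φ N)) Φ ρ u θ 0 →
    ∀ a : ℝ → T3 → ℝ, a 0 = a₀ → (∀ τ ∈ Set.Ico 0 T, Continuous (a τ) ∧ ∀ x, 0 < a τ x) →
    (∀ τ ∈ Set.Ico 0 T, ∀ χ : T3 → ℝ, Literature.Analysis.FunctionSpaces.Torus.IsSmooth χ →
    Tendsto (fun N : ℕ => ∫ z, empiricalDensityField z χ ∂(localGibbsLaw σ (a τ) (u τ) (θ τ) N (Φ N))) atTop (𝓝 (∫ x, χ x * ρ τ x)) ∧ (∀ j : Fin 3, Tendsto (fun N : ℕ => ∫ z, empiricalMomentumField z χ j ∂(localGibbsLaw σ (a τ) (u τ) (θ τ) N (Φ N))) atTop (𝓝 (∫ x, χ x * ρ τ x * u τ x j))) ∧ Tendsto (fun N : ℕ => ∫ z, empiricalEnergyField z χ ∂(localGibbsLaw σ (a τ) (u τ) (θ τ) N (Φ N))) atTop (𝓝 (∫ x, χ x * totalEnergyDensity (ρ τ x) (u τ x) (θ τ x))))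 →
    ∀ t ∈ Set.Ico 0 T, ∃ η'₀ : ℝ, 0 < η'₀ ∧ ∀ η' : ℝ, 0 < η' → η' < η'₀ → ∃ N₀ : ℕ, ∀ N : ℕ, N₀ ≤ N →
    ∀ τ : ℝ, 0 ≤ τ → τ ≤ t → EpisodeWeightBound σ (a τ) (u τ) (θ τ) N (Φ N) η' K ϵ₁

/-! ## §2 Stubs (registered; `sorry` only inside them) — hardest: `stub_separatedPairAdditivity` -/

/-- **S1 (L; the heart).** Separated-pair additivity with episode termination, slaved form. -/
theorem stub_separatedPairAdditivity : Sig.stub_separatedPairAdditivity := by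
  sorry

/-- **S2 (M–L).** Episode slaving from the uniform conditional weight bound. -/
theorem stub_episodeSlaving : Sig.stub_episodeSlaving := by
  sorry

/-- **S3 (M–L).** Prompt re-encounters are rare in the dilute band (the conditional weight bound). -/
theorem stub_episodeWeight : Sig.stub_episodeWeight := by
  sorry

/-! ## §3 Composition (sorry-free) -/

/-- The arithmetic of the split `I = (I − I_K) + I_K` at half budgets. -/
theorem abs_le_of_split {I J e q k : ℝ} (h₁ : |I - J| ≤ e / 2 * q + k / 2) (h₂ : |J| ≤ e / 2 * q + k / 2) :
    |I| ≤ e * q + k := by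
  calc |I| = |(I - J) + J| := by rw [sub_add_cancel]
    _ ≤ |I - J| + |J| := abs_add_le _ _
    _ ≤ e * q + k := by linarith

/-- **The line closes the crux modulo its stubs**: `SlavedContactSynergy` BY NAME from S1, S2, S3. Real content:
the window `K` and the band `η₁` from S1 at `ϵ/2`; the conditional-weight threshold `ϵ₁` and the band `η₂` from S2
at `ϵ/2`; the band `η₃` from S3 at `(K, ϵ₁)`; common thresholds `min η₁ (min η₂ η₃)`, `min σ₁ (min σ₂ σ₃)`,
`min e₁ (min e₂ e₃)` (thickening), `max N₁ (max N₂ N₃)`; S3's conclusion discharges S2's hypothesis by name; the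
triangle inequality at `κ'/2 + κ'/2`. -/
theorem SlavedContactSynergy_of (h₁ : Sig.stub_separatedPairAdditivity) (h₂ : Sig.stub_episodeSlaving)
    (h₃ : Sig.stub_episodeWeight) : ResponseRigidity.SlavedContactSynergy := by
  intro ϵ hϵ
  obtain ⟨K, hK, η₁, hη₁, H₁⟩ := h₁ (ϵ / 2) (half_pos hϵ)
  obtain ⟨ϵ₁, hϵ₁, η₂, hη₂, H₂⟩ := h₂ (ϵ / 2) (half_pos hϵ)
  obtain ⟨η₃, hη₃, H₃⟩ := h₃ K hK ϵ₁ hϵ₁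
  refine ⟨min η₁ (min η₂ η₃), lt_min hη₁ (lt_min hη₂ hη₃), ?_⟩
  intro a₀ θ₀ u₀ ha hθ hu hap hθp
  obtain ⟨σ₁, hσ₁, G₁⟩ := H₁ a₀ θ₀ u₀ ha hθ hu hap hθp
  obtain ⟨σ₂, hσ₂, G₂⟩ := H₂ a₀ θ₀ u₀ ha hθ hu hap hθp
  obtain ⟨σ₃, hσ₃, G₃⟩ := H₃ a₀ θ₀ u₀ ha hθ hu hap hθp
  refine ⟨min σ₁ (min σ₂ σ₃), lt_min hσ₁ (lt_min hσ₂ hσ₃), ?_⟩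
  intro σ hσ hσlt T ρ θ u hsol hpack Φ h0 a ha0 hapos hLLN t ht χ hχ φw hφc hφb p hpc hpg hperp hunit δ hδ κ' hκ'
  have hσ₁' : σ < σ₁ := lt_of_lt_of_le hσlt (min_le_left _ _)
  have hσ₂' : σ < σ₂ := lt_of_lt_of_le hσlt ((min_le_right _ _).trans (min_le_left _ _))
  have hσ₃' : σ < σ₃ := lt_of_lt_of_le hσlt ((min_le_right _ _).trans (min_le_right _ _))
  have hp₁ : ∀ t' ∈ Set.Ico 0 T, ∀ x, ρ t' x * σ ^ 3 < η₁ :=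
    fun t' ht' x => lt_of_lt_of_le (hpack t' ht' x) (min_le_left _ _)
  have hp₂ : ∀ t' ∈ Set.Ico 0 T, ∀ x, ρ t' x * σ ^ 3 < η₂ :=
    fun t' ht' x => lt_of_lt_of_le (hpack t' ht' x) ((min_le_right _ _).trans (min_le_left _ _))
  have hp₃ : ∀ t' ∈ Set.Ico 0 T, ∀ x, ρ t' x * σ ^ 3 < η₃ :=
    fun t' ht' x => lt_of_lt_of_le (hpack t' ht' x) ((min_le_right _ _).trans (min_le_right _ _))
  obtain ⟨e₁, he₁, T₁⟩ := G₁ σ hσ hσ₁' T ρ θ u hsol hp₁ Φ h0 a ha0 hapos hLLN t ht χ hχ φw hφc hφb p hpc hpg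
    hperp hunit δ hδ (κ' / 2) (half_pos hκ')
  obtain ⟨e₂, he₂, T₂⟩ := G₂ σ hσ hσ₂' T ρ θ u hsol hp₂ Φ h0 a ha0 hapos hLLN t ht χ hχ φw hφc hφb p hpc hpg
    hperp hunit δ hδ K hK (κ' / 2) (half_pos hκ')
  obtain ⟨e₃, he₃, T₃⟩ := G₃ σ hσ hσ₃' T ρ θ u hsol hp₃ Φ h0 a ha0 hapos hLLN t ht
  refine ⟨min e₁ (min e₂ e₃), lt_min he₁ (lt_min he₂ he₃), ?_⟩
  intro η' hη' hη'lt
  obtain ⟨N₁, M₁⟩ := T₁ η' hη' (lt_of_lt_of_le hη'lt (min_le_left _ _))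
  obtain ⟨N₂, M₂⟩ := T₂ η' hη' (lt_of_lt_of_le hη'lt ((min_le_right _ _).trans (min_le_left _ _)))
  obtain ⟨N₃, M₃⟩ := T₃ η' hη' (lt_of_lt_of_le hη'lt ((min_le_right _ _).trans (min_le_right _ _)))
  refine ⟨max N₁ (max N₂ N₃), ?_⟩
  intro N hN s τ hs hτ hst
  have hN₁ : N₁ ≤ N := le_trans (le_max_left _ _) hN
  have hN₂ : N₂ ≤ N := le_trans ((le_max_left _ _).trans (le_max_right _ _)) hN
  have hN₃ : N₃ ≤ N := le_trans ((le_max_right _ _).trans (le_max_right _ _)) hN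
  have hτt : τ ≤ t := by linarith
  have R₁ := M₁ N hN₁ s τ hs hτ hst
  have R₂ := M₂ N hN₂ s τ hs hτ hst
  have R₃ := M₃ N hN₃ τ hτ hτt
  intro G3 P m0 m1 m01 ψ ψout wt A Zn F hF α γ β hαc hβc hγc μ1 μ1' μ2 S r hr
  have X₁ := R₁ F hF α γ β hαc hβc hγc hr
  have X₂ := R₂ R₃ F hF α γ β hαc hβc hγc hr
  exact abs_le_of_split X₁ X₂

/-- The skeleton instantiated: the crux modulo the three registered stubs. -/
theorem SlavedContactSynergy_skeleton : ResponseRigidity.SlavedContactSynergy :=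
  SlavedContactSynergy_of stub_separatedPairAdditivity stub_episodeSlaving stub_episodeWeight

end Summit.AtomisticToContinuum.HydrodynamicLimit.Cruxes.SlavedContactSynergy.Birth

end
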